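import Literature.MathematicalPhysics.QuantumFieldTheory.Balaban1983to89.B9Eq360PadDeltaCubeY
import Literature.MathematicalPhysics.QuantumFieldTheory.Balaban1983to89.B9Eq359CubeKernelsKnitAtOne
import Literature.MathematicalPhysics.QuantumFieldTheory.Balaban1983to89.B9Eq337CutFieldDirY

/-!
# `Balaban1983to89.B9Eq360PadDeltaCubeYAgree` — [Balaban1985BackgroundPropagators] p. 394 «They depend on the configuration U restricted to Ω₀» FOR PRINT's PADDED
# DIRICHLET CUBE LETTERS, EXACTLY: `padΔ_{□,Ω₀}(U)` READS `U` ONLY ON THE BONDS INSIDE `Ω₀(□)` (the diagonal of the covariant Laplacian is `U`-free), A VARIATION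
# SUPPORTED ON THOSE BONDS IS COMPRESSED BY `Ω₀(□)`, and — at def-Y's cube-level knit legs `parKnitCubeY` — the small field `Ṽ = Uᵘ·𝟙[bond ⊂ Ω₀]` of
# `B9Eq337CutFieldDirY` has `Ω₀(Δ′(1) − Δ′(Ṽ))Ω₀ = Δ′(1) − Δ′(Ṽ)` and `padΔ(Ṽ) = padΔ(Uᵘ)`, `G′_□(Ṽ) = G′_□(Uᵘ)` — the refined locality UNIT 3's stencil form could
# not give at `∂Ω₀(□)` — sub-row G-B9-LETTERS (site sector), seat dag-n06-c g32 UNIT 6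

statement-level skeleton of published theorems with citation tags; proofs where landed; nothing here is a claim about the Yang–Mills mass gap

CITATION HEADER (lean-in-tree rule).  B9 = T. Bałaban, *Propagators for lattice gauge theories in a background field*, Commun. Math. Phys. **99** (1985)
389–434 [Balaban1985BackgroundPropagators] (held `paper:balaban1985-cmp99-background-propagators`; journal page = PDF page + 388): p. 394 l. 24–33 «Δ′_a↾Ω₀ =
Ω₀Δ′_aΩ₀ … Its inverse is denoted by G′, or G′(U). They depend on the configuration U restricted to Ω₀»; (3.23)–(3.24) p. 394; (3.3) p. 390, (3.8) p. 392;
(3.53) p. 400 «Δ_{U′U} = Δ_U − V′₁(A)»; (3.60) p. 402; p. 408 «Ω₀(□) ⊃ Ω₁(□) … Ω₀(□) ⊂ □⁵», «U′ = Uᵘ = e^{iηA}»; Cor. 3.6 p. 408; (3.19) p. 393.  Rows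
B9.(3.24) × B9.(3.60) × B9.Cor3.6 (cells only; no row head changes).

WHY THIS FILE (road P4; UNIT 3 `B9Eq360PadDeltaCubeY`, UNIT 4 `B9Eq359CubeKernelsKnitAtOne`, UNIT 5 `B9Eq337CutFieldDirY`).  UNIT 3's (3.60) for the padded
letters needs `Ω₀(Δ′_{a,□}(1) − Δ′_{a,□}(Ṽ))Ω₀ = Δ′_{a,□}(1) − Δ′_{a,□}(Ṽ)`, and the covariance transfer needs `padΔ_{□,Ω₀}(Ṽ) = padΔ_{□,Ω₀}(Uᵘ)`; both are about rows
of `Ω₀(□)` adjacent to `∂Ω₀(□)`, whose stencils LEAVE `Ω₀(□)`, so UNIT 3's stencil lemma and E's `padDeltaCubeY_congr_of_agree` (all bonds at the sites of `S`) are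
too crude there.  §1 expands the variation of `Δ′_{a,□}(U)` in `U` entry by entry (`∇*_μ∇_μΦ(z) = 2Φ(z) − R(U_μ(z−e_μ))⁻¹Φ(z−e_μ) − R(U_μ(z))Φ(z+e_μ)`: only
off-diagonal entries move), §2 derives the two exact statements for any `par`, §3 specialises to `parKnitCubeY` and the cut field: outside `Ω₀ × Ω₀` the cube
averaging pairs are level-`0` pairs with trivial legs; inside, the knit legs of a block read the bonds inside that block (UNIT 4) ⊂ `{lev_□ ≥ 1} ⊆ Ω₀(□)` (g31's
`mem_dirDomC_of_lev_pos`).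

WHAT IS PROVED (0 `def`; 0 sorry; 0 new named facts; standard axioms):
* §1 `lapS_term_apply`, ★`lapS_sub_apply`, ★`deltaPrimeACubeY_sub_apply`;
* §2 ★★`padDeltaCubeY_congr_of_agree_inside`, `GpDirY_congr_of_agree_inside`, ★★`compr_sub_compr_eq_of_agree_outside`;
* §3 `knitCubeY_of_levCubeY_eq_zero`, ★`avgTrCubeY_parKnitCubeY_eq_one_of_not`, ★★`compr_sub_compr_eq_cutCfgS` (the `h` of UNIT 3's `DpDirK_sub_conj_vPrimeConc` at
  `par := parKnitCubeY`, `Ṽ := cutCfgS S η A`, given `S ⊇ {lev_□ ≥ 1}`), ★★`padDeltaCubeY_cutCfgS_eq_gaugeY`, `GpDirY_cutCfgS_eq_gaugeY`.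

PROOF.  Ours (bookkeeping over the definitions).

HONEST SCOPE / NOT CLAIMED.  No estimate; the datum (`gaugeY i g U = fluct η A` on `Q ⊇ chart⁻¹S`) is displayed; nothing on `d = 4`, the continuum, reflection
positivity or the mass gap; NOT a node discharge; no row head changes.

RELATED IN THE TREE, NOT DUPLICATED: E's `padDeltaCubeY_congr_of_agree` ∕ `deltaPrimeACubeY_apply_congr_of_agree` (configuration half, all bonds at the sites);
UNIT 3's `compr_sub_compr_eq` (stencil form); n06-d's `B9KnitTransporterLocalityY` (member knit letter).
-/

noncomputable section

namespace Literature.MathematicalPhysics.QuantumFieldTheory.Balaban1983to89.B9Eq360PadDeltaCubeYAgree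

open Literature.MathematicalPhysics.QuantumFieldTheory.Balaban1983to89
open Literature.MathematicalPhysics.QuantumFieldTheory.Balaban1983to89.B9Eq352DivFormLetters (conj)
open Literature.MathematicalPhysics.QuantumFieldTheory.Balaban1983to89.B9Eq360VprimeLetters (vPrimeConc)
open Literature.MathematicalPhysics.QuantumFieldTheory.Balaban1983to89.B9Eq39Adjoint (R R_sub R_zero R_inv_R fluct)
open Literature.MathematicalPhysics.QuantumFieldTheory.Balaban1983to89.B6KLevelCensusIndexV1 (KIdx kGeo)
open Literature.MathematicalPhysics.QuantumFieldTheory.Balaban1983to89.B6Cover236MultiLevelBlocks (cubes)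
open Literature.MathematicalPhysics.QuantumFieldTheory.Balaban1983to89.B9Eq360DeltaPrimeAY (mulY AfldY chartA)
open Literature.MathematicalPhysics.QuantumFieldTheory.Balaban1983to89.B9Eq360DeltaPrimeACubeY (blkCubeY kQCubeY sQCubeY kFCubeY sFCubeY)
open Literature.MathematicalPhysics.QuantumFieldTheory.Balaban1983to89.B9CubeLettersOpsL0 (cubeFamY levCubeY avgCoeffCubeY avgTrCubeY deltaPrimeACubeY
  deltaPrimeACubeY_apply)
open Literature.MathematicalPhysics.QuantumFieldTheory.Balaban1983to89.B9CubeGeometryInputs (geoCK)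
open Literature.MathematicalPhysics.QuantumFieldTheory.Balaban1983to89.B9Cor35GpCubeInputsAtOne (cfunK)
open Literature.MathematicalPhysics.QuantumFieldTheory.Balaban1983to89.B9Cor35GpDirInputsAtOne (dirDomY DpDirK)
open Literature.MathematicalPhysics.QuantumFieldTheory.Balaban1983to89.B9Eq360PadDeltaCubeY (DpDirK_sub_conj_vPrimeConc isUnit_padDeltaCubeY_of_conj_laws)
open Literature.MathematicalPhysics.QuantumFieldTheory.Balaban1983to89.Node00 (SiteY CfgY GaugeY SiteParY toKT shiftY UboxY lapS cdS cdsS gaugeY gaugeY_apply)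
open Literature.MathematicalPhysics.QuantumFieldTheory.Balaban1983to89.B6Geom246MultiLevelBoxL0 (blkOf)
open Literature.MathematicalPhysics.QuantumFieldTheory.Balaban1983to89.B6GlobalChartV1 (PV boxEquiv boxEquiv_apply toBox)
open Literature.MathematicalPhysics.QuantumFieldTheory.Balaban1983to89.B9Eq337CutFieldDirY (cutFldS cutCfgS UboxY_cutCfgS UboxY_cutCfgS_of_not UboxY_cutCfgS_of_mem)
open Literature.MathematicalPhysics.QuantumFieldTheory.Balaban1983to89.B9Thm311CubeLettersFirstThree (levCubeY_eq_of_blkOf_eq)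
open Literature.MathematicalPhysics.QuantumFieldTheory.Balaban1983to89.B9Eq359CubeKernelsKnitAtOne (knitCubeY_congr_of_agree_block blkCubeY_eq_of_avgCoeffCubeY_ne_zero
  avgTrCubeY_parKnitCubeY_congr_of_agree_block)
open Literature.MathematicalPhysics.QuantumFieldTheory.Balaban1983to89.Node00.OpsYCubeKnitPar (parKnitCubeY knitCubeY avgTrCubeY_parKnitCubeY)
open Literature.MathematicalPhysics.QuantumFieldTheory.Balaban1983to89.Node00.OpsYLocalInverse (dirPadY cubeProjY cubeProjY_apply compr_congr_of_apply)
open Literature.MathematicalPhysics.QuantumFieldTheory.Balaban1983to89.Node00.OpsYCubeDirInverse (padDeltaCubeY GpDirY padDeltaCubeY_congr)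

variable {d ℓ : ℕ} {hd : 1 ≤ d + 1} {hL : Odd (ℓ + 1) ∧ 1 < ℓ + 1} {b₀ b₁ : ℝ}
variable {𝔸 : Type} [NormedRing 𝔸] [NormedAlgebra ℂ 𝔸] [CompleteSpace 𝔸]

/-! ## §1  The variation of `Δ′_{a,□}(U)` in `U`, entry by entry: the diagonal of the covariant Laplacian is `U`-free -/

section Formula

variable (i : KIdx d ℓ hd hL b₀ b₁) (q : ↥(cubes (toKT i).D.toDomains))

/-- **ONE DIRECTION OF THE COVARIANT LAPLACIAN, EXPANDED**: `(∇*_{U,μ}∇_{U,μ}Φ)(z) = 2Φ(z) − R(U_μ(z−e_μ))⁻¹Φ(z−e_μ) − R(U_μ(z))Φ(z+e_μ)` — the diagonal entry is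
`U`-FREE (`R(u)⁻¹R(u) = 1`). [cite: Balaban1985BackgroundPropagators, (3.23) p.394, (3.3) p.390, (3.8) p.392] -/
theorem lapS_term_apply (U : CfgY 𝔸 i) (μ : Fin (d + 1)) (Φ : SiteY i → 𝔸) (z : SiteY i) :
    cdsS i U μ (cdS i U μ Φ) z =
      (Φ z + Φ z) - R (UboxY i U μ ((shiftY i μ).symm z))⁻¹ (Φ ((shiftY i μ).symm z)) - R (UboxY i U μ z) (Φ (shiftY i μ z)) := by
  show R (UboxY i U μ ((shiftY i μ).symm z))⁻¹
        (R (UboxY i U μ ((shiftY i μ).symm z)) (Φ (shiftY i μ ((shiftY i μ).symm z))) - Φ ((shiftY i μ).symm z)) -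
      (R (UboxY i U μ z) (Φ (shiftY i μ z)) - Φ z) = _
  rw [Equiv.apply_symm_apply, R_sub, R_inv_R]
  abel

/-- ★ **THE VARIATION OF THE COVARIANT LAPLACIAN IN THE CONFIGURATION, POINTWISE**: only the `2(d+1)` off-diagonal entries move —
`(Δ_UΦ − Δ_{U′}Φ)(z) = Σ_μ {[R(U′_μ(z−e_μ))⁻¹ − R(U_μ(z−e_μ))⁻¹]Φ(z−e_μ) + [R(U′_μ(z)) − R(U_μ(z))]Φ(z+e_μ)}`.
[cite: Balaban1985BackgroundPropagators, (3.23) p.394, (3.53) p.400 («Δ_{U′U} = Δ_U − V′₁(A)»)] -/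
theorem lapS_sub_apply (U U' : CfgY 𝔸 i) (Φ : SiteY i → 𝔸) (z : SiteY i) :
    lapS i U Φ z - lapS i U' Φ z =
      ∑ μ : Fin (d + 1), ((R (UboxY i U' μ ((shiftY i μ).symm z))⁻¹ (Φ ((shiftY i μ).symm z)) - R (UboxY i U μ ((shiftY i μ).symm z))⁻¹ (Φ ((shiftY i μ).symm z)))
        + (R (UboxY i U' μ z) (Φ (shiftY i μ z)) - R (UboxY i U μ z) (Φ (shiftY i μ z)))) := by
  show (∑ μ, cdsS i U μ (cdS i U μ Φ) z) - (∑ μ, cdsS i U' μ (cdS i U' μ Φ) z) = _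
  rw [← Finset.sum_sub_distrib]
  refine Finset.sum_congr rfl fun μ _ => ?_
  rw [lapS_term_apply, lapS_term_apply]
  abel

/-- ★ **THE VARIATION OF `Δ′_{a,□}(U)` IN THE CONFIGURATION, POINTWISE**: the Laplacian's off-diagonal entries plus the transported averaging kernel.
[cite: Balaban1985BackgroundPropagators, (3.24) p.394, (3.60) p.402] -/
theorem deltaPrimeACubeY_sub_apply (par : SiteParY 𝔸 i) (U U' : CfgY 𝔸 i) (Φ : SiteY i → 𝔸) (z : SiteY i) :
    deltaPrimeACubeY i q par U Φ z - deltaPrimeACubeY i q par U' Φ z =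
      (lapS i U Φ z - lapS i U' Φ z) +
        ∑ w, ((avgCoeffCubeY i q z w : ℝ) : ℂ) • (R (avgTrCubeY i q par U z w) (Φ w) - R (avgTrCubeY i q par U' z w) (Φ w)) := by
  rw [deltaPrimeACubeY_apply, deltaPrimeACubeY_apply]
  simp only [smul_sub, Finset.sum_sub_distrib]
  abel

end Formula

/-! ## §2  Agreement INSIDE `S` suffices for the padded letters; a variation supported on the bonds INSIDE `S` is compressed by `S` -/

section Agree

variable (i : KIdx d ℓ hd hL b₀ b₁) (q : ↥(cubes (toKT i).D.toDomains))

/-- ★★ **`padΔ_S(U)` READS `U` ONLY ON THE BONDS INSIDE `S`** (both endpoints in `S`) and through the averaging transporters of pairs in `S × S` — E's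
`padDeltaCubeY_congr_of_agree` refined at the boundary: the outgoing bonds of `∂S` are cut by `Ω₀` on the right, and the Laplacian's diagonal is `U`-free.  Print: «They depend on
the configuration U restricted to Ω₀». [cite: Balaban1985BackgroundPropagators, p.394 («They depend on the configuration U restricted to Ω₀»), (3.23)–(3.24) p.394] -/
theorem padDeltaCubeY_congr_of_agree_inside (par : SiteParY 𝔸 i) (S : Finset (SiteY i)) {U U' : CfgY 𝔸 i}
    (hF : ∀ z ∈ S, ∀ μ, shiftY i μ z ∈ S → UboxY i U μ z = UboxY i U' μ z)
    (hB : ∀ z ∈ S, ∀ μ, (shiftY i μ).symm z ∈ S → UboxY i U μ ((shiftY i μ).symm z) = UboxY i U' μ ((shiftY i μ).symm z))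
    (hpar : ∀ z ∈ S, ∀ w, avgCoeffCubeY i q z w ≠ 0 → w ∈ S → avgTrCubeY i q par U z w = avgTrCubeY i q par U' z w) :
    padDeltaCubeY i q par S U = padDeltaCubeY i q par S U' := by
  refine padDeltaCubeY_congr i q par S (compr_congr_of_apply i S fun Λ hΛ z hz => ?_)
  refine sub_eq_zero.1 ?_
  rw [deltaPrimeACubeY_sub_apply, lapS_sub_apply]
  refine (congrArg₂ (· + ·) (Finset.sum_eq_zero fun μ _ => ?_) (Finset.sum_eq_zero fun w _ => ?_)).trans (add_zero 0)
  · -- the two Laplacian entries at `z` in the direction `μ`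
    have hb : R (UboxY i U' μ ((shiftY i μ).symm z))⁻¹ (Λ ((shiftY i μ).symm z)) - R (UboxY i U μ ((shiftY i μ).symm z))⁻¹ (Λ ((shiftY i μ).symm z)) = 0 := by
      by_cases hs : (shiftY i μ).symm z ∈ S
      · rw [hB z hz μ hs, sub_self]
      · rw [hΛ _ hs, R_zero, R_zero, sub_self]
    have hf : R (UboxY i U' μ z) (Λ (shiftY i μ z)) - R (UboxY i U μ z) (Λ (shiftY i μ z)) = 0 := by
      by_cases hs : shiftY i μ z ∈ S
      · rw [hF z hz μ hs, sub_self]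
      · rw [hΛ _ hs, R_zero, R_zero, sub_self]
    rw [hb, hf, add_zero]
  · by_cases hw : avgCoeffCubeY i q z w = 0
    · rw [hw, Complex.ofReal_zero, zero_smul]
    · by_cases hwS : w ∈ S
      · rw [hpar z hz w hw hwS, sub_self, smul_zero]
      · rw [hΛ _ hwS, R_zero, R_zero, sub_self, smul_zero]

/-- hence the same for `G′_□(U)`. [cite: Balaban1985BackgroundPropagators, p.394 («They depend on the configuration U restricted to Ω₀»)] -/
theorem GpDirY_congr_of_agree_inside (par : SiteParY 𝔸 i) (S : Finset (SiteY i)) {U U' : CfgY 𝔸 i}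
    (hF : ∀ z ∈ S, ∀ μ, shiftY i μ z ∈ S → UboxY i U μ z = UboxY i U' μ z)
    (hB : ∀ z ∈ S, ∀ μ, (shiftY i μ).symm z ∈ S → UboxY i U μ ((shiftY i μ).symm z) = UboxY i U' μ ((shiftY i μ).symm z))
    (hpar : ∀ z ∈ S, ∀ w, avgCoeffCubeY i q z w ≠ 0 → w ∈ S → avgTrCubeY i q par U z w = avgTrCubeY i q par U' z w) :
    GpDirY i q par S U = GpDirY i q par S U' := by
  have h := padDeltaCubeY_congr_of_agree_inside i q par S hF hB hpar
  rw [Node00.OpsYCubeDirInverse.GpDirY_def, Node00.OpsYCubeDirInverse.GpDirY_def, h]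

/-- ★★ **A VARIATION SUPPORTED ON THE BONDS INSIDE `S` IS COMPRESSED BY `S`**: if `U` and `U′` agree on every bond NOT inside `S` (an endpoint outside `S`) and their
averaging transporters agree on every pair not in `S × S`, then `Ω₀(Δ′_{a,□}(U) − Δ′_{a,□}(U′))Ω₀ = Δ′_{a,□}(U) − Δ′_{a,□}(U′)` — the hypothesis `h` of UNIT 3's
`DpDirK_sub_conj_vPrimeConc` for the small field `U′ = Uᵘ` on the bonds inside `Ω₀(□)`, `1` outside (print p.408: the field lives on `Ω₀(□) ⊂ □⁵`).
[cite: Balaban1985BackgroundPropagators, p.394 («Ω₀Δ′_aΩ₀»), p.408 («Ω₀(□) ⊂ □⁵»), (3.60) p.402, (3.23)–(3.24) p.394] -/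
theorem compr_sub_compr_eq_of_agree_outside (par : SiteParY 𝔸 i) (S : Finset (SiteY i)) {U U' : CfgY 𝔸 i}
    (hU : ∀ z μ, ¬ (z ∈ S ∧ shiftY i μ z ∈ S) → UboxY i U μ z = UboxY i U' μ z)
    (hpar : ∀ z w, avgCoeffCubeY i q z w ≠ 0 → ¬ (z ∈ S ∧ w ∈ S) → avgTrCubeY i q par U z w = avgTrCubeY i q par U' z w) :
    cubeProjY i S * (deltaPrimeACubeY i q par U - deltaPrimeACubeY i q par U') * cubeProjY i S =
      deltaPrimeACubeY i q par U - deltaPrimeACubeY i q par U' := by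
  -- each moving entry has its bond / pair inside `S × S`, so it survives both cuts and vanishes at rows off `S`
  have hbwd : ∀ (Λ : SiteY i → 𝔸) (z : SiteY i) (μ : Fin (d + 1)),
      R (UboxY i U' μ ((shiftY i μ).symm z))⁻¹ (Λ ((shiftY i μ).symm z)) - R (UboxY i U μ ((shiftY i μ).symm z))⁻¹ (Λ ((shiftY i μ).symm z)) =
        if z ∈ S then
          R (UboxY i U' μ ((shiftY i μ).symm z))⁻¹ (cubeProjY i S Λ ((shiftY i μ).symm z)) -
            R (UboxY i U μ ((shiftY i μ).symm z))⁻¹ (cubeProjY i S Λ ((shiftY i μ).symm z))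
        else 0 := by
    intro Λ z μ
    by_cases hin : (shiftY i μ).symm z ∈ S ∧ shiftY i μ ((shiftY i μ).symm z) ∈ S
    · rw [Equiv.apply_symm_apply] at hin
      rw [if_pos hin.2, cubeProjY_apply, if_pos hin.1]
    · rw [hU _ μ hin, sub_self]
      split_ifs
      · rw [sub_self]
      · rfl
  have hfwd : ∀ (Λ : SiteY i → 𝔸) (z : SiteY i) (μ : Fin (d + 1)),
      R (UboxY i U' μ z) (Λ (shiftY i μ z)) - R (UboxY i U μ z) (Λ (shiftY i μ z)) =
        if z ∈ S then R (UboxY i U' μ z) (cubeProjY i S Λ (shiftY i μ z)) - R (UboxY i U μ z) (cubeProjY i S Λ (shiftY i μ z)) else 0 := by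
    intro Λ z μ
    by_cases hin : z ∈ S ∧ shiftY i μ z ∈ S
    · rw [if_pos hin.1, cubeProjY_apply, if_pos hin.2]
    · rw [hU _ μ hin, sub_self]
      split_ifs
      · rw [sub_self]
      · rfl
  have havg : ∀ (Λ : SiteY i → 𝔸) (z w : SiteY i),
      ((avgCoeffCubeY i q z w : ℝ) : ℂ) • (R (avgTrCubeY i q par U z w) (Λ w) - R (avgTrCubeY i q par U' z w) (Λ w)) =
        if z ∈ S then ((avgCoeffCubeY i q z w : ℝ) : ℂ) • (R (avgTrCubeY i q par U z w) (cubeProjY i S Λ w) - R (avgTrCubeY i q par U' z w) (cubeProjY i S Λ w))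
        else 0 := by
    intro Λ z w
    by_cases hc : avgCoeffCubeY i q z w = 0
    · rw [hc, Complex.ofReal_zero, zero_smul, zero_smul]; split_ifs <;> rfl
    · by_cases hin : z ∈ S ∧ w ∈ S
      · rw [if_pos hin.1, cubeProjY_apply, if_pos hin.2]
      · rw [hpar z w hc hin, sub_self, smul_zero]
        split_ifs
        · rw [sub_self, smul_zero]
        · rfl
  -- the difference at `Λ` and at `Ω₀Λ`, row by row
  have key : ∀ (Λ : SiteY i → 𝔸) (z : SiteY i),
      deltaPrimeACubeY i q par U Λ z - deltaPrimeACubeY i q par U' Λ z =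
        if z ∈ S then deltaPrimeACubeY i q par U (cubeProjY i S Λ) z - deltaPrimeACubeY i q par U' (cubeProjY i S Λ) z else 0 := by
    intro Λ z
    rw [deltaPrimeACubeY_sub_apply, lapS_sub_apply]
    simp only [hbwd Λ, hfwd Λ, havg Λ]
    split_ifs with hz
    · rw [deltaPrimeACubeY_sub_apply, lapS_sub_apply]
    · simp
  refine LinearMap.ext fun Λ => funext fun z => ?_
  simp only [Module.End.mul_apply, LinearMap.sub_apply, Pi.sub_apply, cubeProjY_apply]
  rw [key Λ z]

end Agree

/-! ## §3  The small field `Ṽ = e^{iηÃ}·1` of road P4 (`B9Eq337CutFieldDirY`) at the (β) letter: its variation is compressed by `Ω₀(□)` and it IS `Uᵘ` for the padded letters -/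

section CutField

variable (i : KIdx d ℓ hd hL b₀ b₁) (c : ↥(cubes (toKT i).D.toDomains))

/-- at cube level `0` the knit leg is trivial (the block is the site). [cite: Balaban1985BackgroundPropagators, (3.19) p.393 («(Q′₀λ)(x) = λ(x)»), bookkeeping] -/
theorem knitCubeY_of_levCubeY_eq_zero (V : CfgY 𝔸 i) {w : SiteY i} (hw : levCubeY i c w = 0) : knitCubeY i c V w = 1 := by
  show B9B8AveragingKernelZd.compT (ℓ + 1) _ (levCubeY i c w) _ _ = 1
  rw [hw, B9B8AveragingKernelZd.compT_zero]

/-- ★ **OUTSIDE `S × S` THE AVERAGING TRANSPORTERS AT `parKnitCubeY` ARE TRIVIAL** when `S ⊇ {lev_□ ≥ 1}`: a pair on the support of the coefficient with a site off `S` is a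
level-`0` pair, both legs `1` — for ANY configuration. [cite: Balaban1985BackgroundPropagators, p.408 («Ω₀(□) ⊃ Ω₁(□)»), (3.19) p.393, (3.24) p.394] -/
theorem avgTrCubeY_parKnitCubeY_eq_one_of_not {S : Finset (SiteY i)} (hS1 : ∀ z : SiteY i, 1 ≤ levCubeY i c z → z ∈ S) (V : CfgY 𝔸 i) {z w : SiteY i}
    (hzw : avgCoeffCubeY i c z w ≠ 0) (h : ¬ (z ∈ S ∧ w ∈ S)) : avgTrCubeY i c (parKnitCubeY i c) V z w = 1 := by
  have hb := blkCubeY_eq_of_avgCoeffCubeY_ne_zero i c hzw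
  have hlev : levCubeY i c w = levCubeY i c z := levCubeY_eq_of_blkOf_eq i c hb
  have hz0 : levCubeY i c z = 0 := by
    by_contra hne
    have h1 : 1 ≤ levCubeY i c z := Nat.one_le_iff_ne_zero.2 hne
    exact h ⟨hS1 z h1, hS1 w (by rw [hlev]; exact h1)⟩
  rw [avgTrCubeY_parKnitCubeY i c V hzw, knitCubeY_of_levCubeY_eq_zero i c V hz0, knitCubeY_of_levCubeY_eq_zero i c V (hlev.trans hz0), inv_one, mul_one]

/-- ★★ **THE VARIATION `Δ′_{a,□}(1) − Δ′_{a,□}(Ṽ)` IS COMPRESSED BY `Ω₀(□)`** at the (β) letter `parKnitCubeY` (`Ω₀(□) ⊇ {lev_□ ≥ 1}` — g31's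
`mem_dirDomC_of_lev_pos`): the hypothesis `h` of UNIT 3's `DpDirK_sub_conj_vPrimeConc` for the small field `Ṽ`. [cite: Balaban1985BackgroundPropagators, p.394 («Ω₀Δ′_aΩ₀»), p.408, (3.60) p.402] -/
theorem compr_sub_compr_eq_cutCfgS {S : Finset (SiteY i)} (hS1 : ∀ z : SiteY i, 1 ≤ levCubeY i c z → z ∈ S) (η : ℝ) (A : AfldY 𝔸 i) :
    cubeProjY i S * (deltaPrimeACubeY i c (parKnitCubeY i c) (fun _ _ => 1) - deltaPrimeACubeY i c (parKnitCubeY i c) (cutCfgS i S η A)) * cubeProjY i S =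
      deltaPrimeACubeY i c (parKnitCubeY i c) (fun _ _ => 1) - deltaPrimeACubeY i c (parKnitCubeY i c) (cutCfgS i S η A) :=
  compr_sub_compr_eq_of_agree_outside i c (parKnitCubeY i c) S (fun _ _ h => UboxY_cutCfgS_of_not i η A h)
    fun z w hzw h => by
      rw [avgTrCubeY_parKnitCubeY_eq_one_of_not i c hS1 _ hzw h, avgTrCubeY_parKnitCubeY_eq_one_of_not i c hS1 _ hzw h]

/-- ★★ **ON THE BONDS INSIDE `Ω₀(□)` THE SMALL FIELD IS `Uᵘ`: `padΔ_{□,Ω₀}(Ṽ) = padΔ_{□,Ω₀}(Uᵘ)`** at `parKnitCubeY` (the cube knit legs of a block of positive level read the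
bonds inside that block ⊂ `{lev_□ ≥ 1} ⊆ Ω₀(□)`; level-`0` legs are trivial). [cite: Balaban1985BackgroundPropagators, p.394 («They depend on the configuration U restricted to Ω₀»), p.408 («U′ = Uᵘ = e^{iηA}»), Cor. 3.6 p.408] -/
theorem padDeltaCubeY_cutCfgS_eq_gaugeY {S : Finset (SiteY i)} (hS1 : ∀ z : SiteY i, 1 ≤ levCubeY i c z → z ∈ S) {η : ℝ} {A : AfldY 𝔸 i} {g : GaugeY 𝔸 i}
    {U : CfgY 𝔸 i} {Q : Set (Site (PV d ℓ i.m i.K hd hL) 0)} (hQ : ∀ z ∈ S, (boxEquiv i.hN).symm z ∈ Q)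
    (hgA : ∀ (κ : Fin (d + 1)) (x : Site (PV d ℓ i.m i.K hd hL) 0), x ∈ Q → x.shift κ ∈ Q → gaugeY i g U κ x = fluct η A κ x) :
    padDeltaCubeY i c (parKnitCubeY i c) S (cutCfgS i S η A) = padDeltaCubeY i c (parKnitCubeY i c) S (gaugeY i g U) := by
  refine padDeltaCubeY_congr_of_agree_inside i c (parKnitCubeY i c) S (fun z hz μ hz' => UboxY_cutCfgS_of_mem i hQ hgA hz hz')
    (fun z hz μ hz' => UboxY_cutCfgS_of_mem i hQ hgA hz' (by rw [Equiv.apply_symm_apply]; exact hz)) fun z hz w hzw hw => ?_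
  rcases Nat.eq_zero_or_pos (levCubeY i c z) with h0 | hpos
  · -- level `0`: both pairs of legs are trivial
    have hb := blkCubeY_eq_of_avgCoeffCubeY_ne_zero i c hzw
    have hw0 : levCubeY i c w = 0 := (levCubeY_eq_of_blkOf_eq i c hb).trans h0
    rw [avgTrCubeY_parKnitCubeY i c _ hzw, avgTrCubeY_parKnitCubeY i c _ hzw, knitCubeY_of_levCubeY_eq_zero i c _ h0, knitCubeY_of_levCubeY_eq_zero i c _ h0,
      knitCubeY_of_levCubeY_eq_zero i c _ hw0, knitCubeY_of_levCubeY_eq_zero i c _ hw0]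
  · -- positive level: the block sits inside `S`, where `Ṽ = Uᵘ`
    refine avgTrCubeY_parKnitCubeY_congr_of_agree_block i c hzw fun v μ hv hv' => ?_
    have hvS : v ∈ S := hS1 v (by rw [levCubeY_eq_of_blkOf_eq i c hv]; exact hpos)
    have hv'S : shiftY i μ v ∈ S := hS1 _ (by rw [levCubeY_eq_of_blkOf_eq i c hv']; exact hpos)
    exact UboxY_cutCfgS_of_mem i hQ hgA hvS hv'S

/-- and hence `G′_□(Ṽ) = G′_□(Uᵘ)`. [cite: Balaban1985BackgroundPropagators, p.394, Cor. 3.6 p.408] -/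
theorem GpDirY_cutCfgS_eq_gaugeY {S : Finset (SiteY i)} (hS1 : ∀ z : SiteY i, 1 ≤ levCubeY i c z → z ∈ S) {η : ℝ} {A : AfldY 𝔸 i} {g : GaugeY 𝔸 i}
    {U : CfgY 𝔸 i} {Q : Set (Site (PV d ℓ i.m i.K hd hL) 0)} (hQ : ∀ z ∈ S, (boxEquiv i.hN).symm z ∈ Q)
    (hgA : ∀ (κ : Fin (d + 1)) (x : Site (PV d ℓ i.m i.K hd hL) 0), x ∈ Q → x.shift κ ∈ Q → gaugeY i g U κ x = fluct η A κ x) :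
    GpDirY i c (parKnitCubeY i c) S (cutCfgS i S η A) = GpDirY i c (parKnitCubeY i c) S (gaugeY i g U) := by
  rw [Node00.OpsYCubeDirInverse.GpDirY_def, Node00.OpsYCubeDirInverse.GpDirY_def, padDeltaCubeY_cutCfgS_eq_gaugeY i c hS1 hQ hgA]

end CutField

end Literature.MathematicalPhysics.QuantumFieldTheory.Balaban1983to89.B9Eq360PadDeltaCubeYAgree

end
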